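import Summits.BirchSwinnertonDyer.BirchSwinnertonDyer.Theorems.TeichmullerTwistDescentStarInvolution
import Summits.BirchSwinnertonDyer.BirchSwinnertonDyer.Theorems.AdditiveKolyvaginRoadManinFrameResidueProperTwistDegree
import Summits.BirchSwinnertonDyer.BirchSwinnertonDyer.Theorems.AdditiveKolyvaginRoadManinFrameTransport
import Literature.NumberTheory.EllipticCurves.CuspFormLFunctionLevelConductorProofs
import HarnessLib

/-!
# Route `TeichmullerTwistDescent`, cruxes PSMU (stmt-BirchSwinnertonDyer-22638) and SCMU57
# (stmt-BirchSwinnertonDyer-22639): THE SANDWICH `ord_p c♭ ≤ ord_p c ≤ ord_p c♭ + 1` FOR AN OPTIMAL STAR PAIR,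
# and Edixhoven's "at most once" on his `p ≥ 11` exception locus as a tree theorem (`--supports`)

Cell `pub/bsd-wall` (D-0145 line route-BirchSwinnertonDyer-TeichmullerTwistDescent, rev 2), seat
`bsd-line-ttd-p1` (prover 1/2, g2, item SCMU57). THEOREMS ONLY (no definition, no named fact, no `sorry`);
nothing is booked, no item is closed, BSD is not proved by this.

* §1 `exists_datum_padicValInt_eq_of_partner` — prime-to-`p` transport of a datum along a `ℚ`-isogeny
  class with `E[p]` irreducible, KEEPING the Manin valuation (`c ↦ k·c`, `p ∤ k`; the tree's
  `ManinFrameTransport.exists_modularParametrizationData_not_dvd_of_partner` with the multiplier exported).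
* §2 **`padicValInt_c_le_one_of_exception`** — for `p ≥ 11`, `V` globally minimal, additive at `p`, `E[p]`
  irreducible, `(G)`-ordinary of type II/III/IV (`ord_p Δ_min ≤ 4`), `D` lattice-optimal at the conductor
  level: **`ord_p c(D) ≤ 1`**, by name modulo Modularity, Edixhoven's Thm. 3 OFF the exception (both tree
  readings) and Dokchitser–Dokchitser. This is the printed clause "in that case, `p` divides `c` at most
  once" of Edixhoven 1991 Thm. 3, which the tree's renderings of Thm. 3 deliberately do not transcribe —
  here DERIVED from the off-exception statement by the star involution (the starred twist carries a
  `p`-good datum, `ManinFrameResidueProperTwistDegree.exists_twistDatum_not_dvd`; then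
  `padicValInt_c_le_one_of_twist_datum`).
* §3 **`padicValInt_c_sandwich_of_optimal_star_pair`** — for `p ≥ 5`, `V` unstarred and `W♭` starred, both
  `X₀`-optimal (lattice-optimal conductor-level data `D`, `D♭`), the two classes twists of each other
  (`V^{(p*)} ∼ W♭`, `W♭^{(p*)} ∼ V`), `E[p]` irreducible: **`ord_p c(D♭) ≤ ord_p c(D) ≤ ord_p c(D♭) + 1`**,
  granted Modularity only. Edixhoven's "case 1 / case 2" (§4, typescript L628–700: `Λ̃ = δΛ` or `δ⁻¹Λ`) as
  two divisibilities at EVERY `p ≥ 5`; with the cell `b2b-bsdres` degree identity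
  (`Additive.padicVal_twist_identity`, any data) it reads `v_p(deg♭) − v_p(deg) = ±1` when the twist model
  is itself optimal (`Additive.dvd_maninConstant_iff_of_strong_twist` is the `p ≥ 11` instance).

References: [EdixhovenManin1991] Thm. 3 (typescript L115–118), §4 (L602–640, L695–710);
[DokchitserDokchitser2015LocalInvariants] Thm. 5.1 (1); [AgasheRibetStein2006] Thm. 2.6, §2;
[SilvermanATAEC1994] IV.5.1, IV.6.1; [ZagierCMB1985] §1.
-/

set_option autoImplicit false
-- single-conjunct summit: `Summit.BirchSwinnertonDyer.BirchSwinnertonDyer.…` repeats the name by design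
set_option linter.dupNamespace false

noncomputable section

open scoped Classical NumberField

open WeierstrassCurve IsDedekindDomain Rat.HeightOneSpectrum
  Literature.NumberTheory.EllipticCurves Literature.NumberTheory.EllipticCurves.ModularForms
  Literature.NumberTheory.EllipticCurves.Rank1Residual Literature.NumberTheory.DiophantineGeometry
  Summit.BirchSwinnertonDyer.Rank1Residual Summit.BirchSwinnertonDyer.Rank1Residual.Additive
  Literature.NumberTheory.Automorphic

namespace Summit.BirchSwinnertonDyer.BirchSwinnertonDyer.Theorems.TeichmullerTwistDescentStarInvolution

/-! ### §1 Prime-to-`p` transport of a datum along the class, keeping the Manin valuation -/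

/-- **Prime-to-`p` transport keeping `ord_p c`.** For globally minimal `W ∼ W'` over `ℚ` with `E[p]`
irreducible and ANY datum `D'` of `W'` (level `N'`), there is a datum of `W` at level `N'` whose Manin
constant has the SAME `p`-adic valuation: the tree's
`ManinFrameTransport.exists_modularParametrizationData_not_dvd_of_partner` with the multiplier made
explicit — `c = k·c'` with `p ∤ k` (`X11b.exists_int_mul_mem_lattice_not_dvd`, Néron mapping property;
`ModularParametrizationData.exists_of_isNewformOf`). [cite: AgasheRibetStein2006, Thm. 2.6 and §2]
[cite: SilvermanATAEC1994, IV.5.1 with IV.6.1] -/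
theorem exists_datum_padicValInt_eq_of_partner
    (W : WeierstrassCurve ℚ) [W.IsElliptic] [W.IsGloballyMinimal] {p : ℕ} (hp : p.Prime)
    (hirr : W.HasIrreducibleModPGaloisRep p)
    {W' : WeierstrassCurve ℚ} [W'.IsElliptic] [W'.IsGloballyMinimal] (hiso : IsIsogenous W W')
    {N' : ℕ} [NeZero N'] (D' : ModularParametrizationData W' N') :
    ∃ Dt : ModularParametrizationData W N', padicValInt p Dt.c = padicValInt p D'.c := by
  haveI : Fact p.Prime := ⟨hp⟩
  haveI : (W.baseChange ℂ).IsElliptic := by rw [WeierstrassCurve.baseChange]; infer_instance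
  have hfW : IsNewformOf W D'.f := D'.isNewformOf.of_isIsogenous hiso
  obtain ⟨LW, hLW⟩ := exists_isNeronLatticeOf_holds (W.baseChange ℂ)
  obtain ⟨k, hk0, hpk, hk⟩ :=
    X11b.exists_int_mul_mem_lattice_not_dvd integral_neronScaling_of_isGloballyMinimal_holds
      hiso.symm_of_charZero D'.isNeronLattice hLW hp hirr
  have hm0 : k * D'.c ≠ 0 := mul_ne_zero hk0 D'.maninConstant_ne_zero_holds
  have hle : ∀ z ∈ periodLattice D'.f, ((k * D'.c : ℤ) : ℂ) * z ∈ LW.lattice := fun z hz ↦ by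
    have h2 := hk _ (D'.smul_periodLattice_le z hz)
    rwa [← mul_assoc, ← Int.cast_mul] at h2
  obtain ⟨D, -, -, hDc⟩ := ModularParametrizationData.exists_of_isNewformOf hfW hLW hm0 hle
  refine ⟨D, ?_⟩
  have hc' : D'.c ≠ 0 := D'.maninConstant_ne_zero_holds
  rw [hDc, padicValInt.mul hk0 hc', padicValInt.eq_zero_of_not_dvd hpk, zero_add]

/-! ### §2 Edixhoven's "at most once" on the exception locus (`p ≥ 11`) -/

section Exception

variable (p : ℕ) [hp : Fact p.Prime]

/-- **"In that case, `p` divides `c` at most once"** (Edixhoven 1991 Thm. 3, the exceptional case —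
the clause the tree's renderings `edixhoven_not_dvd_maninConstant_of_kodairaSymbol_ne` /
`…_of_not_potentiallyGoodOrdinary` do not transcribe) **as a tree theorem, by name modulo Edixhoven's
theorem OFF the exception, Dokchitser–Dokchitser and Modularity**: for a globally minimal `V`,
`p ≥ 11`, additive at `p` with `E[p]` irreducible, `(G)`-ordinary of Kodaira type II/III/IV
(`ord_p Δ_min(V) ≤ 4`), and `D` a LATTICE-OPTIMAL datum at the conductor level: `ord_p c(D) ≤ 1`. The
starred twist carries a `p`-good conductor-level datum
(`ManinFrameResidueProperTwistDegree.exists_twistDatum_not_dvd`: Edixhoven at the optimal curve of the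
twisted class, transported), and `padicValInt_c_le_one_of_twist_datum` (`ord_p u = 0`).
[cite: EdixhovenManin1991, Thm. 3 (typescript L115–118) and §4 (L602–640)]
[cite: DokchitserDokchitser2015LocalInvariants, Thm. 5.1 (1)] -/
theorem padicValInt_c_le_one_of_exception (hnf : exists_isNewformOf)
    (hEdx : edixhoven_not_dvd_maninConstant_of_not_potentiallyGoodOrdinary)
    (hEdxK : edixhoven_not_dvd_maninConstant_of_kodairaSymbol_ne)
    (hDD : dokchitser_padicValInt_minimalDiscriminantInt_eq_of_isogeny_of_not_dvd_degree)
    (hp11 : 11 ≤ p) (V : WeierstrassCurve ℚ) [V.IsElliptic] [V.IsGloballyMinimal]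
    [NeZero (V.conductorNorm ℤ)] (hV : Addv V p) (hirr : Irr V p) (hG : TypeGOrd V p)
    (hV4 : padicValInt p V.minimalDiscriminantInt ≤ 4)
    (D : ModularParametrizationData V (V.conductorNorm ℤ))
    (hopt : ∀ z ∈ D.L.lattice, ∃ w ∈ periodLattice D.f, z = D.c * w) :
    padicValInt p D.c ≤ 1 := by
  have hp2 : p ≠ 2 := by omega
  have hp5 : 5 ≤ p := by omega
  have hj : 0 ≤ padicValRat p V.j := padicValRat_j_nonneg_of_typeGOrd V p hG
  have hV6 : padicValInt p V.minimalDiscriminantInt < 6 := by omega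
  obtain ⟨W, hWe, hWm, C, hC⟩ := exists_minimal_twist_pStar p V
  haveI := hWe
  haveI := hWm
  haveI : NeZero (W.conductorNorm ℤ) := ⟨(conductorNorm_pos_holds W).ne'⟩
  obtain ⟨hW, -, -⟩ := addv_of_twist_pStar p hp2 V W hj hV6 C hC
  obtain ⟨hu, -⟩ := padicValRat_u_eq_zero_and_padicValInt_eq_of_twist_pStar p hp2 V W hV6 C hC
  have hN : W.conductorNorm ℤ = V.conductorNorm ℤ := conductorNorm_eq_of_twist_pStar p hp5 V W hV hW C hC
  obtain ⟨Df, hcf⟩ := ManinFrameResidueProperTwistDegree.exists_twistDatum_not_dvd hnf hEdx hEdxK hDD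
    hp11 V hirr hG hV4 W C hC
  exact padicValInt_c_le_one_of_twist_datum p hp2 V W hV C hC hu D hopt
    (sq_dvd_conductorNorm_of_not_good_of_not_mult hV) (dvd_of_eq hN) Df hcf

end Exception

/-! ### §3 The sandwich for an optimal star pair -/

section Sandwich

variable (p : ℕ) [hp : Fact p.Prime]

/-- **`ord_p c(D♭) ≤ ord_p c(D) ≤ ord_p c(D♭) + 1` for an OPTIMAL star pair.** Granted Modularity
(`hnf`, conductors along a class): let `p ≥ 5`; `V` globally minimal, additive and potentially good at
`p` of UNSTARRED type (`ord_p Δ_min(V) < 6`) with `E[p]` irreducible; `W♭` globally minimal,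
additive and potentially good of STARRED type (`6 < ord_p Δ_min(W♭)`); the two classes twists of each
other (`V^{(p*)} ∼ W♭` and `W♭^{(p*)} ∼ V`); `D`, `D♭` LATTICE-OPTIMAL conductor-level data (both
curves `X₀`-optimal). Then the Manin valuations satisfy the sandwich — Edixhoven's "case 1 / case 2"
dichotomy (1991 §4, typescript L628–640: `Λ̃ = δΛ` or `δ⁻¹Λ`) as two divisibilities, at every
`p ≥ 5`: `ord_p c = ord_p c♭` ("case 2") or `ord_p c = ord_p c♭ + 1` ("case 1"). Each inequality is
`padicValInt_c_le_of_twist_datum` at the optimal curve of one class fed with the datum transported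
(`exists_datum_padicValInt_eq_of_partner`) from the optimal curve of the other.
[cite: EdixhovenManin1991, §4 (typescript L602–640, L695–700)] -/
theorem padicValInt_c_sandwich_of_optimal_star_pair (hnf : exists_isNewformOf) (hp5 : 5 ≤ p)
    (V Wf : WeierstrassCurve ℚ) [V.IsElliptic] [V.IsGloballyMinimal] [Wf.IsElliptic]
    [Wf.IsGloballyMinimal] [NeZero (V.conductorNorm ℤ)] [NeZero (Wf.conductorNorm ℤ)]
    (hV : Addv V p) (hirr : Irr V p) (hjV : 0 ≤ padicValRat p V.j)
    (hV6 : padicValInt p V.minimalDiscriminantInt < 6)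
    (hW : Addv Wf p) (hjW : 0 ≤ padicValRat p Wf.j) (h6 : 6 < padicValInt p Wf.minimalDiscriminantInt)
    (hVW : IsIsogenous (V.quadraticTwist ((-1 : ℚ) ^ (p / 2) * p)) Wf)
    (hWV : IsIsogenous (Wf.quadraticTwist ((-1 : ℚ) ^ (p / 2) * p)) V)
    (D : ModularParametrizationData V (V.conductorNorm ℤ))
    (hopt : ∀ z ∈ D.L.lattice, ∃ w ∈ periodLattice D.f, z = D.c * w)
    (Df : ModularParametrizationData Wf (Wf.conductorNorm ℤ))
    (hoptf : ∀ z ∈ Df.L.lattice, ∃ w ∈ periodLattice Df.f, z = Df.c * w) :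
    padicValInt p Df.c ≤ padicValInt p D.c ∧ padicValInt p D.c ≤ padicValInt p Df.c + 1 := by
  have hp2 : p ≠ 2 := by omega
  have hpP : p.Prime := hp.out
  have hd0 : ((-1 : ℚ) ^ (p / 2) * p) ≠ 0 := pStar_ne_zero p
  haveI : (V.quadraticTwist ((-1 : ℚ) ^ (p / 2) * p)).IsElliptic := V.isElliptic_quadraticTwist hd0
  haveI : (Wf.quadraticTwist ((-1 : ℚ) ^ (p / 2) * p)).IsElliptic := Wf.isElliptic_quadraticTwist hd0
  -- `E[p]` irreducible throughout
  have hirrVt : Irr (V.quadraticTwist ((-1 : ℚ) ^ (p / 2) * p)) p :=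
    BurungaleSkinnerTianWan2024.hasIrreducibleModPGaloisRep_of_smul_eq_quadraticTwist V _ p hd0 (C := 1) (one_smul _ _) hirr
  have hirrW : Irr Wf p := (X12.irr_iff_of_isIsogenous hVW p).mp hirrVt
  constructor
  · -- `ord c♭ ≤ ord c`: at the starred optimal `Wf`, fed with the datum of `V` moved to `V₁ ≅ Wf^{(p*)}`
    obtain ⟨V₁, hV₁e, hV₁m, C₁, hC₁⟩ := exists_minimal_twist_pStar p Wf
    haveI := hV₁e
    haveI := hV₁m
    obtain ⟨hV₁, -, -, -, hu₁⟩ := unstarred_twist_of_starred p hp5 Wf V₁ hW hjW h6 C₁ hC₁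
    have hirrV₁ : Irr V₁ p :=
      BurungaleSkinnerTianWan2024.hasIrreducibleModPGaloisRep_of_smul_eq_quadraticTwist Wf V₁ p hd0 (C := C₁⁻¹)
        (by rw [← hC₁, inv_smul_smul]) hirrW
    have hiso₁ : IsIsogenous V₁ V := (isIsogenous_of_smul_eq' hC₁).trans' hWV
    obtain ⟨D₁, hD₁⟩ := exists_datum_padicValInt_eq_of_partner V₁ hpP hirrV₁ hiso₁ D
    have hN₁ : V.conductorNorm ℤ = V₁.conductorNorm ℤ :=
      IsNewformOf.level_eq_conductorNorm_of_exists_isNewformOf hnf D₁.isNewformOf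
    have hNW : V₁.conductorNorm ℤ = Wf.conductorNorm ℤ :=
      conductorNorm_eq_of_twist_pStar p hp5 Wf V₁ hW hV₁ C₁ hC₁
    have hle := padicValInt_c_le_of_twist_datum p hp2 Wf V₁ hW C₁ hC₁ Df hoptf
      (sq_dvd_conductorNorm_of_not_good_of_not_mult hW) (dvd_of_eq (hN₁.trans hNW)) D₁
    rw [hu₁, hD₁] at hle
    push_cast at hle
    omega
  · -- `ord c ≤ ord c♭ + 1`: at the unstarred optimal `V`, fed with the datum of `Wf` moved to `V'`
    obtain ⟨V', hV'e, hV'm, C, hC⟩ := exists_minimal_twist_pStar p V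
    haveI := hV'e
    haveI := hV'm
    obtain ⟨hV', -, -⟩ := addv_of_twist_pStar p hp2 V V' hjV hV6 C hC
    obtain ⟨hu, -⟩ := padicValRat_u_eq_zero_and_padicValInt_eq_of_twist_pStar p hp2 V V' hV6 C hC
    have hirrV' : Irr V' p :=
      BurungaleSkinnerTianWan2024.hasIrreducibleModPGaloisRep_of_smul_eq_quadraticTwist V V' p hd0 (C := C⁻¹)
        (by rw [← hC, inv_smul_smul]) hirr
    have hiso' : IsIsogenous V' Wf := (isIsogenous_of_smul_eq' hC).trans' hVW
    obtain ⟨Dt, hDt⟩ := exists_datum_padicValInt_eq_of_partner V' hpP hirrV' hiso' Df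
    have hNt : Wf.conductorNorm ℤ = V'.conductorNorm ℤ :=
      IsNewformOf.level_eq_conductorNorm_of_exists_isNewformOf hnf Dt.isNewformOf
    have hNV : V'.conductorNorm ℤ = V.conductorNorm ℤ :=
      conductorNorm_eq_of_twist_pStar p hp5 V V' hV hV' C hC
    have hle := padicValInt_c_le_of_twist_datum p hp2 V V' hV C hC D hopt
      (sq_dvd_conductorNorm_of_not_good_of_not_mult hV) (dvd_of_eq (hNt.trans hNV)) Dt
    rw [hu, hDt] at hle
    push_cast at hle
    omega

end Sandwich

end Summit.BirchSwinnertonDyer.BirchSwinnertonDyer.Theorems.TeichmullerTwistDescentStarInvolution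

end
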